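import Summits.BirchSwinnertonDyer.BirchSwinnertonDyer.Theorems.QuadraticBranchSignedControlNoFiniteSubmoduleOfStrictLayers
import Summits.BirchSwinnertonDyer.Rank1Residual.Additive.QuadraticTwistTowerNoPTorsion
import Literature.NumberTheory.EllipticCurves.IwasawaSelmerControlKernelProofs
import HarnessLib

/-!
# Kobayashi's Lemma 9.1 / Kitajima–Otsuki's Lemma 4.2 for the Gss2 rows, IN THE KERNEL: the
# restrictions `Sel^{ε,str}(W/ℚ_n) → Sel^{ε,str}(W/ℚ_∞)` are injective for EVERY `n` (not only
# `n = 0`), because `W(ℚ_∞)[p^∞] = 0` for the `p*`-twist `W` of a good supersingular curve — so the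
# injectivity clause of the Hachimori–Matsuno package on the tree's layers is DISCHARGED
# (cell `bsd-potss`, seat `bsd-potss-k8q-c5` g3; route `QuadraticBranchSignedControl`,
# items stmt-BirchSwinnertonDyer-19117 / 19222 / 19233)

HONEST FRAMING (cell `bsd-potss`, run/shared/lean/pub/bsd-potss/): THEOREMS ONLY; the node stays
CONDITIONAL (settled by citation); BSD is not proved by any of this; no label / mark / count moves.
Sequel of `…NoFiniteSubmoduleOfStrictLayers` (p452849: exhaustion and `Γ`-action discharged). Here:
(§1) for ANY number field `K`, `ℤ_p`-extension `κ` with topological generator `γ` and elliptic `W/K`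
with `W(K_∞)[p^∞] = 0` (`hB`), the restriction `h_n : H¹(K_n, W[p^∞]) → H¹(K_∞, W[p^∞])`
(`layerToInfty κ n`) is injective for every `n` — Greenberg's Lemma 3.1 bound
`#ker h_n ≤ #(B/(γ^{pⁿ}−1)B)` (tree `finite_ker_layerToInfty_and_card_le`) with `B = 0`; the tree had
the case `n = 0` (`SignedControlZero.layerToInfty_zero_injective`); (§2) for the Gss2 rows of the K8
items (`W/ℚ`, `p ≠ 2`, `C • W^{(p*)} = V` with `V` good supersingular `a_p = 0`) `hB` is the tree's
`fixedPoints_kerSubgroup_geomPrimaryTorsion_eq_bot_of_quadraticTwist` (gen-32 model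
`exists_goodSupersingularPadicModel`, `p*` not a square), so the package's clause "`r_n` injective" is a
THEOREM; (§3) the three K8 decls from the REDUCED package (displayed now: transitions, corestriction +
adjointness, divisible parts with stabilisation, the Cassels–Tate-type pairings — and the pinning of
`r_n`, `γL_n` to `layerToInfty`, `conj_γ`).

References: [Kobayashi2003] Lemma 9.1 (p. 25), Prop. 8.7 (p. 16); [KitajimaOtsuki2018] Lemma 4.2
(arXiv:1607.03612 p. 18); [GreenbergLNM1716] §3 Lemma 3.1 (p. 86); [HachimoriMatsuno2000] Theorem.
-/

set_option autoImplicit false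
-- `Summit.BirchSwinnertonDyer.BirchSwinnertonDyer.…` is the lane's mandated namespace (sub = summit).
set_option linter.dupNamespace false

noncomputable section

open scoped Classical

universe u

open WeierstrassCurve Field Literature.NumberTheory.EllipticCurves
  Literature.NumberTheory.GaloisRepresentations ZpExtension
  Summit.BirchSwinnertonDyer.Rank1Residual Summit.BirchSwinnertonDyer.Rank1Residual.Additive

namespace Summit.BirchSwinnertonDyer.BirchSwinnertonDyer.Theorems

open Summit.BirchSwinnertonDyer.BirchSwinnertonDyer.Theses.QuadraticBranchSignedControl

/-! ## §1 `h_n` is injective for every `n` when `W(K_∞)[p^∞] = 0` -/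

section Injective

variable {K : Type u} [Field K] [NumberField K] (W : WeierstrassCurve K) {p : ℕ}
  [Fact p.Prime] (κ : ZpExtension K p) {γ : Field.absoluteGaloisGroup K}

/-- **Greenberg's Lemma 3.1 with `B = 0`, every layer**: if `B = W[p^∞]^{Gal(K̄/K_∞)} = W(K_∞)[p^∞]`
is trivial, then `h_n : H¹(K_n, W[p^∞]) → H¹(K_∞, W[p^∞])` (`layerToInfty κ n`) is injective for every
`n` — `#ker h_n ≤ #(B/(γ^{pⁿ} − 1)B) = 1` (`finite_ker_layerToInfty_and_card_le`); the tree's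
`SignedControlZero.layerToInfty_zero_injective` is the case `n = 0`, same proof.
[cite: GreenbergLNM1716, §3 Lemma 3.1 (p. 86)] [cite: Kobayashi2003, Lemma 9.1 (p. 25)] -/
theorem layerToInfty_injective_of_fixedPoints_eq_bot (hγ : κ.IsTopGenerator γ)
    (hB : FixedPoints.addSubgroup κ.kerSubgroup (W.geomPrimaryTorsion p) = ⊥) (n : ℕ) :
    Function.Injective (W.layerToInfty κ n) := by
  haveI hsub : Subsingleton (FixedPoints.addSubgroup κ.kerSubgroup (W.geomPrimaryTorsion p)) := by
    rw [hB]; infer_instance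
  haveI hfinQ : Finite (FixedPoints.addSubgroup κ.kerSubgroup (geomPrimaryTorsion W p) ⧸
      (ResKernel.subOne κ.kerSubgroup (geomPrimaryTorsion W p) (γ ^ p ^ n)).range) :=
    Finite.of_surjective _ (QuotientAddGroup.mk'_surjective _)
  have hcardQ : Nat.card (FixedPoints.addSubgroup κ.kerSubgroup (geomPrimaryTorsion W p) ⧸
      (ResKernel.subOne κ.kerSubgroup (geomPrimaryTorsion W p) (γ ^ p ^ n)).range) ≤ 1 := by
    rw [Finite.card_le_one_iff_subsingleton]
    refine ⟨fun a b ↦ ?_⟩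
    obtain ⟨a, rfl⟩ := QuotientAddGroup.mk'_surjective _ a
    obtain ⟨b, rfl⟩ := QuotientAddGroup.mk'_surjective _ b
    rw [Subsingleton.elim a b]
  obtain ⟨hfin, hle⟩ := W.finite_ker_layerToInfty_and_card_le κ hγ n
  haveI := hfin
  haveI : Subsingleton (W.layerToInfty κ n).ker :=
    Finite.card_le_one_iff_subsingleton.mp (hle.trans hcardQ)
  rw [← AddMonoidHom.ker_eq_bot_iff]
  exact (W.layerToInfty κ n).ker.eq_bot_of_subsingleton

variable {W κ} {E : Type u} [Field E] [Algebra K E] {ε : ℤˣ}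

/-- **The package's injectivity clause from `hB`**: a map `r_n : Sel^{ε,str}(W/K_n) → Sel^{ε,str}(W/K_∞)`
pinned to `layerToInfty κ n` by its values is injective once `W(K_∞)[p^∞] = 0`.
[cite: Kobayashi2003, Lemma 9.1 (p. 25)] [cite: GreenbergLNM1716, §3 Lemma 3.1 (p. 86)] -/
theorem strictLayer_r_injective_of_fixedPoints_eq_bot (hγ : κ.IsTopGenerator γ)
    (hB : FixedPoints.addSubgroup κ.kerSubgroup (W.geomPrimaryTorsion p) = ⊥)
    (r : ∀ n, strictSignedSelmerLayer W κ E ε n →+ strictSignedSelmerInfty W κ E ε)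
    (hr : ∀ n (x : strictSignedSelmerLayer W κ E ε n),
      ((r n x : strictSignedSelmerInfty W κ E ε) : W.subgroupH1 p κ.kerSubgroup) =
        W.layerToInfty κ n (x : W.subgroupH1 p (κ.layerSubgroup n)))
    (n : ℕ) : Function.Injective (r n) := by
  intro x y hxy
  apply Subtype.ext
  apply layerToInfty_injective_of_fixedPoints_eq_bot W κ hγ hB n
  rw [← hr, ← hr, hxy]

end Injective

/-! ## §2 The Gss2 rows: `W(ℚ_∞)[p^∞] = 0` for the `p*`-twist of a good supersingular curve -/

/-- **(hB) on the Gss2 rows**: for `W/ℚ`, `p ≠ 2`, `C • W^{(p*)} = V` with `V/ℚ` globally minimal,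
good at `p`, `a_p(V) = 0`, and ANY `ℤ_p`-extension `κ` of `ℚ`: `W[p^∞]^{Gal(ℚ̄/ℚ_∞)} = 0` — the tree's
`fixedPoints_kerSubgroup_geomPrimaryTorsion_eq_bot_of_quadraticTwist` fed by the gen-32 model
`exists_goodSupersingularPadicModel` and `sq_ne_neg_one_pow_mul_prime` (`p*` is not a square).
[cite: Kobayashi2003, Prop. 8.7 (p. 16), Lemma 9.1 (p. 25)] -/
theorem fixedPoints_eq_bot_of_gss2 {p : ℕ} [hp : Fact p.Prime] (κ : ZpExtension ℚ p) (hp2 : p ≠ 2)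
    (W : WeierstrassCurve ℚ) (C : VariableChange ℚ) {V : WeierstrassCurve ℚ} [V.IsElliptic]
    [V.IsGloballyMinimal] (hCV : C • W.quadraticTwist ((-1) ^ (p / 2) * p) = V)
    (hgood : V.HasGoodReductionAtPrime p) (hap : V.frobeniusTrace p = 0) :
    FixedPoints.addSubgroup κ.kerSubgroup (W.geomPrimaryTorsion p) = ⊥ := by
  obtain ⟨M, hΔ, hA, hVM⟩ := exists_goodSupersingularPadicModel hp2 V hgood hap
  exact fixedPoints_kerSubgroup_geomPrimaryTorsion_eq_bot_of_quadraticTwist κ hp2 W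
    (sq_ne_neg_one_pow_mul_prime hp.out (p / 2)) C hCV M hΔ hA hVM


/-! ## §3 The K8 nodes from the REDUCED package on the tree's layers (injectivity no longer displayed) -/

/-- **(R2⁺) `NoFiniteSubmodulePlus` (item stmt-BirchSwinnertonDyer-19222) from the Hachimori–Matsuno
package on the tree's layers `Sel^{+,str}(W/ℚ_n)` WITHOUT the injectivity clause** (Kobayashi's
Lemma 9.1 is now the kernel theorem `strictLayer_r_injective_of_fixedPoints_eq_bot` +
`fixedPoints_eq_bot_of_gss2`; exhaustion and `Γ`-action by p452849). Displayed: transitions,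
corestriction + adjointness, divisible parts with stabilisation, Cassels–Tate-type pairings.
CONDITIONAL; closes nothing by itself. [cite: HachimoriMatsuno2000, Theorem and Corollary (i) (p. 2540)]
[cite: Kobayashi2003, Def. 2.1, Thm. 2.2 (p. 5), Lemma 9.1 (p. 25)] -/
theorem noFiniteSubmodulePlus_of_strictLayerPackage'
    (h : ∀ (W : WeierstrassCurve ℚ) [W.IsElliptic] [W.IsGloballyMinimal] (p : ℕ) [Fact p.Prime]
        (V : WeierstrassCurve ℚ) [V.IsElliptic] [V.IsGloballyMinimal] (C : VariableChange ℚ),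
      5 ≤ p → C • W.quadraticTwist ((-1) ^ (p / 2) * p) = V →
      V.HasGoodReductionAtPrime p → V.frobeniusTrace p = 0 →
      ∀ (κ : ZpExtension ℚ p) (γ : Field.absoluteGaloisGroup ℚ),
        κ.IsCyclotomic → κ.IsTopGenerator γ →
      ∀ (D : StrictSignedSelmerDualData W κ ℚ_[p] γ 1),
        Module.Finite (IwasawaAlgebra p) D.X → Module.IsTorsion (IwasawaAlgebra p) D.X →
      ∃ (r : ∀ n, strictSignedSelmerLayer W κ ℚ_[p] 1 n →+ strictSignedSelmerInfty W κ ℚ_[p] 1)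
        (γL : ∀ n, strictSignedSelmerLayer W κ ℚ_[p] 1 n →+ strictSignedSelmerLayer W κ ℚ_[p] 1 n)
        (ι : ∀ n, strictSignedSelmerLayer W κ ℚ_[p] 1 n →+ strictSignedSelmerLayer W κ ℚ_[p] 1 (n + 1))
        (Dn : ∀ n, AddSubgroup (strictSignedSelmerLayer W κ ℚ_[p] 1 n))
        (pair : ∀ n, strictSignedSelmerLayer W κ ℚ_[p] 1 n →+ strictSignedSelmerLayer W κ ℚ_[p] 1 n →+ AddCircle (1 : ℚ)) (m : ℕ),
      (∀ n (x : strictSignedSelmerLayer W κ ℚ_[p] 1 n),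
        ((r n x : strictSignedSelmerInfty W κ ℚ_[p] 1) : W.subgroupH1 p κ.kerSubgroup) =
          W.layerToInfty κ n (x : W.subgroupH1 p (κ.layerSubgroup n))) ∧
      (∀ n (x : strictSignedSelmerLayer W κ ℚ_[p] 1 n),
        ((γL n x : strictSignedSelmerLayer W κ ℚ_[p] 1 n) : W.subgroupH1 p (κ.layerSubgroup n)) =
          W.conjH1 p (κ.layerSubgroup n) γ (x : W.subgroupH1 p (κ.layerSubgroup n))) ∧
      (∀ n (x : strictSignedSelmerLayer W κ ℚ_[p] 1 n), r (n + 1) (ι n x) = r n x) ∧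
      (∀ n (t : strictSignedSelmerLayer W κ ℚ_[p] 1 (n + 1)), ∃ t' : strictSignedSelmerLayer W κ ℚ_[p] 1 n,
        r n t' = ∑ i ∈ Finset.range p,
          ((conjStrictSignedSelmerInfty W κ ℚ_[p] 1 γ) ^ (p ^ n * i)) (r (n + 1) t) ∧
        ∀ y : strictSignedSelmerLayer W κ ℚ_[p] 1 n, pair n y t' = pair (n + 1) (ι n y) t) ∧
      (∀ n, ∀ d ∈ Dn n, ∃ d' ∈ Dn n, p • d' = d) ∧
      (∀ n, ∀ d ∈ Dn n, γL n d ∈ Dn n) ∧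
      (∀ n, m ≤ n → (Dn (n + 1)).map (r (n + 1)) ≤ (Dn n).map (r n)) ∧
      (∀ n (t : strictSignedSelmerLayer W κ ℚ_[p] 1 n),
        (∀ y : strictSignedSelmerLayer W κ ℚ_[p] 1 n, pair n y t = 0) → t ∈ Dn n) ∧
      (∀ n, ∀ t ∈ Dn n, ∀ y : strictSignedSelmerLayer W κ ℚ_[p] 1 n, pair n y t = 0) ∧
      (∀ n (g : strictSignedSelmerLayer W κ ℚ_[p] 1 n →+ AddCircle (1 : ℚ)), (∀ d ∈ Dn n, g d = 0) →
        ∃ c : strictSignedSelmerLayer W κ ℚ_[p] 1 n, ∀ y : strictSignedSelmerLayer W κ ℚ_[p] 1 n, g y = pair n y c) ∧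
      (∀ n (y t : strictSignedSelmerLayer W κ ℚ_[p] 1 n), pair n (γL n y) (γL n t) = pair n y t)) :
    NoFiniteSubmodulePlus := by
  intro W _ _ p _ hp5 V _ _ C hp2 hC hgood hap κ γ hκ hγ D hfin htor M hM
  obtain ⟨r, γL, ι, Dn, pair, m, hr, hγL, hι, hcores, hDdiv, hDγ, hDst, hker, hD0, hsurj, hinv⟩ :=
    h W p V C hp5 hC hgood hap κ γ hκ hγ D hfin htor
  exact StrictSignedSelmerDualData.forall_finite_eq_bot_of_strictLayerPackage D
    ⟨r, γL, ι, Dn, pair, m, hr, hγL,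
      strictLayer_r_injective_of_fixedPoints_eq_bot hγ (fixedPoints_eq_bot_of_gss2 κ hp2 W C hC hgood hap)
        r hr,
      hι, hcores, hDdiv, hDγ, hDst, hker, hD0, hsurj, hinv⟩ M hM

/-- **(R2⁻) `NoFiniteSubmoduleMinus` (item stmt-BirchSwinnertonDyer-19233), same reduction** (strict
minus condition, `m = −1` clause). CONDITIONAL; closes nothing by itself.
[cite: HachimoriMatsuno2000, Theorem and Corollary (i) (p. 2540)]
[cite: Kobayashi2003, Def. 2.1, §2 p. 4 (m = −1), Thm. 2.2 (p. 5), Lemma 9.1 (p. 25)] -/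
theorem noFiniteSubmoduleMinus_of_strictLayerPackage'
    (h : ∀ (W : WeierstrassCurve ℚ) [W.IsElliptic] [W.IsGloballyMinimal] (p : ℕ) [Fact p.Prime]
        (V : WeierstrassCurve ℚ) [V.IsElliptic] [V.IsGloballyMinimal] (C : VariableChange ℚ),
      5 ≤ p → C • W.quadraticTwist ((-1) ^ (p / 2) * p) = V →
      V.HasGoodReductionAtPrime p → V.frobeniusTrace p = 0 →
      ∀ (κ : ZpExtension ℚ p) (γ : Field.absoluteGaloisGroup ℚ),
        κ.IsCyclotomic → κ.IsTopGenerator γ →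
      ∀ (D : StrictSignedSelmerDualData W κ ℚ_[p] γ (-1)),
        Module.Finite (IwasawaAlgebra p) D.X → Module.IsTorsion (IwasawaAlgebra p) D.X →
      ∃ (r : ∀ n, strictSignedSelmerLayer W κ ℚ_[p] (-1) n →+ strictSignedSelmerInfty W κ ℚ_[p] (-1))
        (γL : ∀ n, strictSignedSelmerLayer W κ ℚ_[p] (-1) n →+ strictSignedSelmerLayer W κ ℚ_[p] (-1) n)
        (ι : ∀ n, strictSignedSelmerLayer W κ ℚ_[p] (-1) n →+ strictSignedSelmerLayer W κ ℚ_[p] (-1) (n + 1))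
        (Dn : ∀ n, AddSubgroup (strictSignedSelmerLayer W κ ℚ_[p] (-1) n))
        (pair : ∀ n, strictSignedSelmerLayer W κ ℚ_[p] (-1) n →+ strictSignedSelmerLayer W κ ℚ_[p] (-1) n →+ AddCircle (1 : ℚ)) (m : ℕ),
      (∀ n (x : strictSignedSelmerLayer W κ ℚ_[p] (-1) n),
        ((r n x : strictSignedSelmerInfty W κ ℚ_[p] (-1)) : W.subgroupH1 p κ.kerSubgroup) =
          W.layerToInfty κ n (x : W.subgroupH1 p (κ.layerSubgroup n))) ∧
      (∀ n (x : strictSignedSelmerLayer W κ ℚ_[p] (-1) n),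
        ((γL n x : strictSignedSelmerLayer W κ ℚ_[p] (-1) n) : W.subgroupH1 p (κ.layerSubgroup n)) =
          W.conjH1 p (κ.layerSubgroup n) γ (x : W.subgroupH1 p (κ.layerSubgroup n))) ∧
      (∀ n (x : strictSignedSelmerLayer W κ ℚ_[p] (-1) n), r (n + 1) (ι n x) = r n x) ∧
      (∀ n (t : strictSignedSelmerLayer W κ ℚ_[p] (-1) (n + 1)), ∃ t' : strictSignedSelmerLayer W κ ℚ_[p] (-1) n,
        r n t' = ∑ i ∈ Finset.range p,
          ((conjStrictSignedSelmerInfty W κ ℚ_[p] (-1) γ) ^ (p ^ n * i)) (r (n + 1) t) ∧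
        ∀ y : strictSignedSelmerLayer W κ ℚ_[p] (-1) n, pair n y t' = pair (n + 1) (ι n y) t) ∧
      (∀ n, ∀ d ∈ Dn n, ∃ d' ∈ Dn n, p • d' = d) ∧
      (∀ n, ∀ d ∈ Dn n, γL n d ∈ Dn n) ∧
      (∀ n, m ≤ n → (Dn (n + 1)).map (r (n + 1)) ≤ (Dn n).map (r n)) ∧
      (∀ n (t : strictSignedSelmerLayer W κ ℚ_[p] (-1) n),
        (∀ y : strictSignedSelmerLayer W κ ℚ_[p] (-1) n, pair n y t = 0) → t ∈ Dn n) ∧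
      (∀ n, ∀ t ∈ Dn n, ∀ y : strictSignedSelmerLayer W κ ℚ_[p] (-1) n, pair n y t = 0) ∧
      (∀ n (g : strictSignedSelmerLayer W κ ℚ_[p] (-1) n →+ AddCircle (1 : ℚ)), (∀ d ∈ Dn n, g d = 0) →
        ∃ c : strictSignedSelmerLayer W κ ℚ_[p] (-1) n, ∀ y : strictSignedSelmerLayer W κ ℚ_[p] (-1) n, g y = pair n y c) ∧
      (∀ n (y t : strictSignedSelmerLayer W κ ℚ_[p] (-1) n), pair n (γL n y) (γL n t) = pair n y t)) :
    NoFiniteSubmoduleMinus := by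
  intro W _ _ p _ hp5 V _ _ C hp2 hC hgood hap κ γ hκ hγ D hfin htor M hM
  obtain ⟨r, γL, ι, Dn, pair, m, hr, hγL, hι, hcores, hDdiv, hDγ, hDst, hker, hD0, hsurj, hinv⟩ :=
    h W p V C hp5 hC hgood hap κ γ hκ hγ D hfin htor
  exact StrictSignedSelmerDualData.forall_finite_eq_bot_of_strictLayerPackage D
    ⟨r, γL, ι, Dn, pair, m, hr, hγL,
      strictLayer_r_injective_of_fixedPoints_eq_bot hγ (fixedPoints_eq_bot_of_gss2 κ hp2 W C hC hgood hap)
        r hr,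
      hι, hcores, hDdiv, hDγ, hDst, hker, hD0, hsurj, hinv⟩ M hM

/-- **(R2±) the K8 node `NoFiniteSubmoduleSigned` (item stmt-BirchSwinnertonDyer-19117) from both
REDUCED packages on the tree's layers.** CONDITIONAL; closes nothing by itself. What is displayed is
exactly: transitions `Sel^{ε,str}(ℚ_n) → Sel^{ε,str}(ℚ_{n+1})` over `Sel_∞`, corestrictions realising the
norm with res/cores adjointness, the divisible parts `D_n` (`p`-divisible, `conj_γ`-stable, images
stationary from some `m`) and `conj_γ`-invariant pairings on `Sel^{ε,str}(W/ℚ_n)` with right kernel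
exactly `D_n` representing every character of the quotient — the generalised Cassels–Tate input.
[cite: HachimoriMatsuno2000, Theorem and Corollary (i) (p. 2540)]
[cite: KitajimaOtsuki2018, Main Thm. 1.3, Prop. 4.1, Lemma 4.2, Thm. 4.5 (arXiv:1607.03612 pp. 3, 18)] -/
theorem noFiniteSubmoduleSigned_of_strictLayerPackages'
    (hplus : ∀ (W : WeierstrassCurve ℚ) [W.IsElliptic] [W.IsGloballyMinimal] (p : ℕ) [Fact p.Prime]
        (V : WeierstrassCurve ℚ) [V.IsElliptic] [V.IsGloballyMinimal] (C : VariableChange ℚ),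
      5 ≤ p → C • W.quadraticTwist ((-1) ^ (p / 2) * p) = V →
      V.HasGoodReductionAtPrime p → V.frobeniusTrace p = 0 →
      ∀ (κ : ZpExtension ℚ p) (γ : Field.absoluteGaloisGroup ℚ),
        κ.IsCyclotomic → κ.IsTopGenerator γ →
      ∀ (D : StrictSignedSelmerDualData W κ ℚ_[p] γ 1),
        Module.Finite (IwasawaAlgebra p) D.X → Module.IsTorsion (IwasawaAlgebra p) D.X →
      ∃ (r : ∀ n, strictSignedSelmerLayer W κ ℚ_[p] 1 n →+ strictSignedSelmerInfty W κ ℚ_[p] 1)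
        (γL : ∀ n, strictSignedSelmerLayer W κ ℚ_[p] 1 n →+ strictSignedSelmerLayer W κ ℚ_[p] 1 n)
        (ι : ∀ n, strictSignedSelmerLayer W κ ℚ_[p] 1 n →+ strictSignedSelmerLayer W κ ℚ_[p] 1 (n + 1))
        (Dn : ∀ n, AddSubgroup (strictSignedSelmerLayer W κ ℚ_[p] 1 n))
        (pair : ∀ n, strictSignedSelmerLayer W κ ℚ_[p] 1 n →+ strictSignedSelmerLayer W κ ℚ_[p] 1 n →+ AddCircle (1 : ℚ)) (m : ℕ),
      (∀ n (x : strictSignedSelmerLayer W κ ℚ_[p] 1 n),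
        ((r n x : strictSignedSelmerInfty W κ ℚ_[p] 1) : W.subgroupH1 p κ.kerSubgroup) =
          W.layerToInfty κ n (x : W.subgroupH1 p (κ.layerSubgroup n))) ∧
      (∀ n (x : strictSignedSelmerLayer W κ ℚ_[p] 1 n),
        ((γL n x : strictSignedSelmerLayer W κ ℚ_[p] 1 n) : W.subgroupH1 p (κ.layerSubgroup n)) =
          W.conjH1 p (κ.layerSubgroup n) γ (x : W.subgroupH1 p (κ.layerSubgroup n))) ∧
      (∀ n (x : strictSignedSelmerLayer W κ ℚ_[p] 1 n), r (n + 1) (ι n x) = r n x) ∧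
      (∀ n (t : strictSignedSelmerLayer W κ ℚ_[p] 1 (n + 1)), ∃ t' : strictSignedSelmerLayer W κ ℚ_[p] 1 n,
        r n t' = ∑ i ∈ Finset.range p,
          ((conjStrictSignedSelmerInfty W κ ℚ_[p] 1 γ) ^ (p ^ n * i)) (r (n + 1) t) ∧
        ∀ y : strictSignedSelmerLayer W κ ℚ_[p] 1 n, pair n y t' = pair (n + 1) (ι n y) t) ∧
      (∀ n, ∀ d ∈ Dn n, ∃ d' ∈ Dn n, p • d' = d) ∧
      (∀ n, ∀ d ∈ Dn n, γL n d ∈ Dn n) ∧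
      (∀ n, m ≤ n → (Dn (n + 1)).map (r (n + 1)) ≤ (Dn n).map (r n)) ∧
      (∀ n (t : strictSignedSelmerLayer W κ ℚ_[p] 1 n),
        (∀ y : strictSignedSelmerLayer W κ ℚ_[p] 1 n, pair n y t = 0) → t ∈ Dn n) ∧
      (∀ n, ∀ t ∈ Dn n, ∀ y : strictSignedSelmerLayer W κ ℚ_[p] 1 n, pair n y t = 0) ∧
      (∀ n (g : strictSignedSelmerLayer W κ ℚ_[p] 1 n →+ AddCircle (1 : ℚ)), (∀ d ∈ Dn n, g d = 0) →
        ∃ c : strictSignedSelmerLayer W κ ℚ_[p] 1 n, ∀ y : strictSignedSelmerLayer W κ ℚ_[p] 1 n, g y = pair n y c) ∧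
      (∀ n (y t : strictSignedSelmerLayer W κ ℚ_[p] 1 n), pair n (γL n y) (γL n t) = pair n y t))
    (hminus : ∀ (W : WeierstrassCurve ℚ) [W.IsElliptic] [W.IsGloballyMinimal] (p : ℕ) [Fact p.Prime]
        (V : WeierstrassCurve ℚ) [V.IsElliptic] [V.IsGloballyMinimal] (C : VariableChange ℚ),
      5 ≤ p → C • W.quadraticTwist ((-1) ^ (p / 2) * p) = V →
      V.HasGoodReductionAtPrime p → V.frobeniusTrace p = 0 →
      ∀ (κ : ZpExtension ℚ p) (γ : Field.absoluteGaloisGroup ℚ),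
        κ.IsCyclotomic → κ.IsTopGenerator γ →
      ∀ (D : StrictSignedSelmerDualData W κ ℚ_[p] γ (-1)),
        Module.Finite (IwasawaAlgebra p) D.X → Module.IsTorsion (IwasawaAlgebra p) D.X →
      ∃ (r : ∀ n, strictSignedSelmerLayer W κ ℚ_[p] (-1) n →+ strictSignedSelmerInfty W κ ℚ_[p] (-1))
        (γL : ∀ n, strictSignedSelmerLayer W κ ℚ_[p] (-1) n →+ strictSignedSelmerLayer W κ ℚ_[p] (-1) n)
        (ι : ∀ n, strictSignedSelmerLayer W κ ℚ_[p] (-1) n →+ strictSignedSelmerLayer W κ ℚ_[p] (-1) (n + 1))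
        (Dn : ∀ n, AddSubgroup (strictSignedSelmerLayer W κ ℚ_[p] (-1) n))
        (pair : ∀ n, strictSignedSelmerLayer W κ ℚ_[p] (-1) n →+ strictSignedSelmerLayer W κ ℚ_[p] (-1) n →+ AddCircle (1 : ℚ)) (m : ℕ),
      (∀ n (x : strictSignedSelmerLayer W κ ℚ_[p] (-1) n),
        ((r n x : strictSignedSelmerInfty W κ ℚ_[p] (-1)) : W.subgroupH1 p κ.kerSubgroup) =
          W.layerToInfty κ n (x : W.subgroupH1 p (κ.layerSubgroup n))) ∧
      (∀ n (x : strictSignedSelmerLayer W κ ℚ_[p] (-1) n),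
        ((γL n x : strictSignedSelmerLayer W κ ℚ_[p] (-1) n) : W.subgroupH1 p (κ.layerSubgroup n)) =
          W.conjH1 p (κ.layerSubgroup n) γ (x : W.subgroupH1 p (κ.layerSubgroup n))) ∧
      (∀ n (x : strictSignedSelmerLayer W κ ℚ_[p] (-1) n), r (n + 1) (ι n x) = r n x) ∧
      (∀ n (t : strictSignedSelmerLayer W κ ℚ_[p] (-1) (n + 1)), ∃ t' : strictSignedSelmerLayer W κ ℚ_[p] (-1) n,
        r n t' = ∑ i ∈ Finset.range p,
          ((conjStrictSignedSelmerInfty W κ ℚ_[p] (-1) γ) ^ (p ^ n * i)) (r (n + 1) t) ∧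
        ∀ y : strictSignedSelmerLayer W κ ℚ_[p] (-1) n, pair n y t' = pair (n + 1) (ι n y) t) ∧
      (∀ n, ∀ d ∈ Dn n, ∃ d' ∈ Dn n, p • d' = d) ∧
      (∀ n, ∀ d ∈ Dn n, γL n d ∈ Dn n) ∧
      (∀ n, m ≤ n → (Dn (n + 1)).map (r (n + 1)) ≤ (Dn n).map (r n)) ∧
      (∀ n (t : strictSignedSelmerLayer W κ ℚ_[p] (-1) n),
        (∀ y : strictSignedSelmerLayer W κ ℚ_[p] (-1) n, pair n y t = 0) → t ∈ Dn n) ∧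
      (∀ n, ∀ t ∈ Dn n, ∀ y : strictSignedSelmerLayer W κ ℚ_[p] (-1) n, pair n y t = 0) ∧
      (∀ n (g : strictSignedSelmerLayer W κ ℚ_[p] (-1) n →+ AddCircle (1 : ℚ)), (∀ d ∈ Dn n, g d = 0) →
        ∃ c : strictSignedSelmerLayer W κ ℚ_[p] (-1) n, ∀ y : strictSignedSelmerLayer W κ ℚ_[p] (-1) n, g y = pair n y c) ∧
      (∀ n (y t : strictSignedSelmerLayer W κ ℚ_[p] (-1) n), pair n (γL n y) (γL n t) = pair n y t)) :
    NoFiniteSubmoduleSigned :=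
  noFiniteSubmoduleSigned_of_signs (noFiniteSubmodulePlus_of_strictLayerPackage' hplus)
    (noFiniteSubmoduleMinus_of_strictLayerPackage' hminus)

end Summit.BirchSwinnertonDyer.BirchSwinnertonDyer.Theorems

end
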